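import Summits.QuantumFields.YangMills.Theorems.BalabanUVNodesN15PerCubeGreenObjects
import Summits.QuantumFields.YangMills.Theorems.BalabanUVNodesN15CovariantLandauProjection
import Summits.QuantumFields.YangMills.Theorems.BalabanUVNodesN15CovariantLandauLeibniz
import Summits.QuantumFields.YangMills.Theorems.BalabanUVNodesN15CovariantLandauTwoGridPhiQ
import Summits.QuantumFields.YangMills.Theorems.BalabanUVNodesN15CovariantLandauTwoGridGrad
import Summits.QuantumFields.YangMills.Theorems.BalabanUVNodesN15BumpCoverLift
import HarnessLib

/-!
# N15 = NE2, road (c) — PROGRAMME (PC), FILE B: THE ROWS OF THE SCALAR COVARIANT GREEN's FUNCTION KNIT — block-locality of the flat nonlocal part `a·Q′ᵀQ′ ⊗ 1`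
# (52's tail row VANISHES, the commutator row is the in-block oscillation of `h_k`), the exact locality `M_{h_k}Δ′_a(1)(G′(1)M_{ψ_k}) = M_{h_k}`, the generic
# cut∕pull-back bookkeeping, and the site windows (dag-n15-c g26, n15-c∕261)

Cell `pub-ymgap`, seat `pub-ymgap-dag-n15-c` (generation g26; R134 (a), s1; HUMAN RULING D-0062; chair R424 venue).  `bears_on: R4∕N15 · K3⁸ SpineGivenEndpointR13SepCoPHV
(stmt-QuantumFields-27366)`; filed `--supports stmt-QuantumFields-27366 --as helper` — COUNT-NEUTRAL.  Theorems only; 0 `sorry`.  Imports BY NAME n15-c∕260 `…PerCubeGreenObjects`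
(the objects), n15-c∕201b `…CovariantLandauProjection` (`claplA_mul_cGreen`), n15-c∕213 `…CovariantLandauLeibniz` (`cgrad_one_transpose_mulVec`), n15-c∕250 `…CovariantLandauTwoGridPhiQ`
(`csavg_transpose_mul_csavg_apply`), dag-n15-a `…CovariantLandauTwoGridGrad` (`bBack`, `bBack_mulVec`), dag-n15-w4 `…BumpCoverLift` (the bond-carrier bump rows; through it the generic
lattice files `…BumpLattice`∕`…PartitionLattice`).  Nothing in the tree is modified.

WHAT (52's binder names in brackets).
* §1 generic sharp-block bookkeeping: `hasMaj_comp_mulOp_cut` (a source cut supported in `S` inserts `1_S(y′)`), `hasMaj_mulOp_cut_comp` (a target cut inserts `1_S(y)`),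
  `hasMaj_pullCarrier_comp` (a pull-back along a block-compatible map of carriers keeps the majorant).
* §2 the site coordinates: `scXi_shift_lift` (FILE 61's `hξ` for the lifted site shifts, step `(L^kL^m)⁻¹`, period `2L`), ★ `scChi_lift_eq_one_of_near_bbox` (the lifted window).
* §3 the flat operator: ★ `lapOp_scShift_eq` (`Σ_μ ∇*_μ∇_μ = mulVecLin (∂ᵀ∂ ⊗ 1)` on sites), ★★ `lapOp_add_scQQ_comp_cGreen` (`(Σ∇*∇ + a·Q′ᵀQ′)∘G′(1) = 1`: n15-c∕201b `claplA_mul_cGreen`),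
  `mulOp_scH_comp_mulOp_scPsi` [hhψ], ★★ `loc0_scCube` [hloc0], `scCube_comp_mulOp_scPsi` [hNψ].
* §4 block locality of `a·Q′ᵀQ′ ⊗ 1`: ★ `scQQ_apply` (an in-block sum, diagonal in the colour), `abs_scXi_sub_scXi_le_of_blockOf_eq` (`≤ 1∕w` inside a block),
  `scBump_eq_one_of_scH_ne_zero_of_blockOf_eq` (the bump covers the blocks of `supp h_k`, `w ≥ 2`), ★★ `mulOp_scH_comp_scQQ_comp_one_sub_scBump` (`M_{h_k}∘N_L∘M_{1−χ̃_k} = 0` ⟹ [hT] with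
  `ε₀ = 0`), ★★ `hasMaj_commOp_scQQ` [hKN]: `[N_L, M_{h_k}] ≤ 𝟙·(a n^{−(d+1)})·2π(d+1)∕w`.
* (sequel n15-c∕261b `…PerCubeGreenCutRows`: the cut rows [hcut hcutF hcutB] from the flat rows of `G′(1)`, `∂G′(1)`, `S̄ₕ∂G′(1)`.)

HONEST FRAMING ∕ LIMITS.  Finite-dimensional bookkeeping over LANDED rows on MODEL carriers (doubled-cube torus cover, one scale, unit weights, torus local propagators); the flat rows
are King's `A = 0` rung read on Bałaban's flat objects (dag-n15-e ∕ dag-n15-a lineage); [B9] (3.24)–(3.25) p.394, (3.62)–(3.65) pp.402–403, (3.87)–(3.90) pp.409–410 = SHAPES ∕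
MECHANISM, nothing of [B5]∕[B6]∕[B9] asserted.  NE2⁺ NOT PRINTED, NOT proved; N15 of record untouched (DISCHARGED AS CONSUMED, p687738); K3⁸ OPEN; counts of record UNMOVED (typed
28∕28 · discharged 8∕27); one finite 𝕋⁴ at fixed ε per index — NOT infinite volume, NOT OS on ℝ⁴, NOT a mass gap, NOT Clay.  Restate-immune (no Theses import).
-/

noncomputable section

open scoped BigOperators Matrix

namespace Summit.QuantumFields.YangMills.BalabanUVNodes.N15.Gluing

open Real
open Literature.MathematicalPhysics.QuantumFieldTheory.Balaban1983to89
open Literature.MathematicalPhysics.QuantumFieldTheory.Balaban1983to89.B5Prop11Plancherel (Tor fine unitVec)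
open Literature.MathematicalPhysics.QuantumFieldTheory.Balaban1983to89.B11SectG (BlockNorm HasMaj)
open Literature.MathematicalPhysics.QuantumFieldTheory.Balaban1983to89.B6Prop26Gluing (mulOp mulOp_apply ind ind_nonneg)
open Literature.MathematicalPhysics.QuantumFieldTheory.Balaban1983to89.B6UnitTorusCarrier (unitTorusGeo)
open Literature.MathematicalPhysics.QuantumFieldTheory.Balaban1983to89.T4EtaRateCoeffDefect (pull pull_apply)
open Literature.MathematicalPhysics.QuantumFieldTheory.Balaban1983to89.B11AxialTransport190 (abs_le_loc_ofBlocks loc_ofBlocks_le)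
open Literature.MathematicalPhysics.QuantumFieldTheory.King1986.Torus (blockOf val_blockOf tdistT tdistT_nonneg tdistT_symm tdistT_self)
open Summit.QuantumFields.YangMills.BalabanUVNodes.N15.BackgroundLayer (fgrad fgradAdj bgrad fgrad_apply fgradAdj_apply bgrad_apply)
open Summit.QuantumFields.YangMills.BalabanUVNodes.N15.VectorPiece (bshiftEquiv bshiftEquiv_apply tdistT_blockOf_sub_unitVec_le)
open Summit.QuantumFields.YangMills.BalabanUVNodes.N15.MatrixSpecies (liftBlk liftEquiv liftEquiv_apply liftEquiv_symm_apply)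
open Summit.QuantumFields.YangMills.BalabanUVNodes.N15.TwoGrid (chiCube cubeBlocks chiCube_of_not_mem abs_chiCube_le_one)
open Summit.QuantumFields.YangMills.BalabanUVNodes.N15.CovLandau (cgrad csavg claplA cGreen cgrad_mulVec claplA_mul_cGreen cgrad_one_transpose_mulVec csavg_transpose_mul_csavg_apply bBack bBack_mulVec
  card_fibre_blockOf_fine)
open Summit.QuantumFields.YangMills.BalabanUVNodes.N15.CovAvg (cvaStair_one)

variable {d : ℕ}

/-! ## §1 Generic sharp-block bookkeeping -/

section Generic

variable {g : B6.Geometry} {X X' F : Type} [Fintype X] [Fintype X'] [AddCommGroup F] [Module ℝ F]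

/-- A SOURCE CUT supported over the block set `S` (`|χ| ≤ 1`) inserts the indicator `1_S(y′)` into any nonnegative majorant. [folklore] -/
theorem hasMaj_comp_mulOp_cut {b₂ : BlockNorm g F} (blk : X → g.Site) {T : (X → ℝ) →ₗ[ℝ] F} {K : g.Site → g.Site → ℝ} (hK : ∀ y y', 0 ≤ K y y')
    {χ : X → ℝ} {S : Set g.Site} (hχ1 : ∀ x, |χ x| ≤ 1) (hχS : ∀ x, χ x ≠ 0 → blk x ∈ S) (hT : HasMaj (BlockNorm.ofBlocks g blk) b₂ T K) :
    HasMaj (BlockNorm.ofBlocks g blk) b₂ (T ∘ₗ mulOp χ) (fun y y' => ind S y' * K y y') := by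
  classical
  intro y' μ hμ y
  dsimp only
  have hμ' : (BlockNorm.ofBlocks g blk).IsLoc y' (mulOp χ μ) := fun x hx => by show χ x * μ x = 0; rw [hμ x hx, mul_zero]
  by_cases hy' : y' ∈ S
  · have hi : ind S y' = 1 := by simp [ind, hy']
    rw [hi, one_mul, LinearMap.comp_apply]
    refine (hT y' _ hμ' y).trans (mul_le_mul_of_nonneg_left ?_ (hK y y'))
    refine loc_ofBlocks_le blk _ ((BlockNorm.ofBlocks g blk).loc_nonneg y' μ) fun x hx => ?_
    rw [mulOp_apply, abs_mul]
    exact (mul_le_of_le_one_left (abs_nonneg _) (hχ1 x)).trans (abs_le_loc_ofBlocks blk μ hx)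
  · have hzero : mulOp χ μ = 0 := by
      funext x
      rw [mulOp_apply, Pi.zero_apply]
      by_cases hx : blk x = y'
      · have hχ0 : χ x = 0 := by
          by_contra h
          exact hy' (hx ▸ hχS x h)
        rw [hχ0, zero_mul]
      · rw [hμ x hx, mul_zero]
    rw [LinearMap.comp_apply, hzero, map_zero, b₂.loc_zero]
    exact mul_nonneg (mul_nonneg (ind_nonneg _ _) (hK y y')) ((BlockNorm.ofBlocks g blk).loc_nonneg y' μ)

/-- A TARGET CUT supported over the block set `S` (`|χ| ≤ 1`) inserts the indicator `1_S(y)` into any nonnegative majorant. [folklore] -/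
theorem hasMaj_mulOp_cut_comp {b₁ : BlockNorm g F} (blk : X → g.Site) {T : F →ₗ[ℝ] (X → ℝ)} {K : g.Site → g.Site → ℝ} (hK : ∀ y y', 0 ≤ K y y')
    {χ : X → ℝ} {S : Set g.Site} (hχ1 : ∀ x, |χ x| ≤ 1) (hχS : ∀ x, χ x ≠ 0 → blk x ∈ S) (hT : HasMaj b₁ (BlockNorm.ofBlocks g blk) T K) :
    HasMaj b₁ (BlockNorm.ofBlocks g blk) (mulOp χ ∘ₗ T) (fun y y' => ind S y * K y y') := by
  classical
  intro y' μ hμ y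
  dsimp only
  by_cases hy : y ∈ S
  · have hi : ind S y = 1 := by simp [ind, hy]
    rw [hi, one_mul]
    refine loc_ofBlocks_le blk _ (mul_nonneg (hK y y') (b₁.loc_nonneg y' μ)) fun x hx => ?_
    rw [LinearMap.comp_apply, mulOp_apply, abs_mul]
    exact (mul_le_of_le_one_left (abs_nonneg _) (hχ1 x)).trans ((abs_le_loc_ofBlocks blk _ hx).trans (hT y' μ hμ y))
  · have hi : ind S y = 0 := by simp [ind, hy]
    rw [hi, zero_mul, zero_mul]
    refine loc_ofBlocks_le blk _ le_rfl fun x hx => ?_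
    rw [LinearMap.comp_apply, mulOp_apply]
    have hχ0 : χ x = 0 := by
      by_contra h
      exact hy (hx ▸ hχS x h)
    rw [hχ0, zero_mul, abs_zero]

/-- A PULL-BACK ALONG A BLOCK-COMPATIBLE MAP OF CARRIERS keeps the majorant: `T ≤ K` into the blocks `blk` ⟹ `(f ↦ (Tf)∘φ) ≤ K` into the blocks `blk∘φ`. [folklore] -/
theorem hasMaj_pullCarrier_comp {b₁ : BlockNorm g F} (blk : X → g.Site) (blk' : X' → g.Site) (φ : X' → X) (hφ : ∀ x', blk' x' = blk (φ x')) {T : F →ₗ[ℝ] (X → ℝ)}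
    {K : g.Site → g.Site → ℝ} (hK : ∀ y y', 0 ≤ K y y') (hT : HasMaj b₁ (BlockNorm.ofBlocks g blk) T K) : HasMaj b₁ (BlockNorm.ofBlocks g blk') (pull φ ∘ₗ T) K := by
  intro y' μ hμ y
  refine loc_ofBlocks_le blk' _ (mul_nonneg (hK y y') (b₁.loc_nonneg y' μ)) fun x' hx' => ?_
  rw [LinearMap.comp_apply, pull_apply]
  exact (abs_le_loc_ofBlocks blk (T μ) ((hφ x').symm.trans hx')).trans (hT y' μ hμ y)

end Generic

/-! ## §2 The site coordinates: shift compatibility and the lifted window -/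

section Coordinates

variable {L : ℕ} [NeZero L] {mv kk : ℕ} {hL : Odd L ∧ 1 < L} (R : ℝ) (ι : Type)

/-- FILE 61's `hξ` for the lifted SITE shifts: `ξ_ν(x + e_μ) = ξ_ν(x) + δ_{νμ}(L^kL^m)⁻¹ + z·2L` (FILE 66 `coverXi_shift` at the bond `(x, 0)`). [folklore] -/
theorem scXi_shift_lift (hM : ∀ ν, cvM d L mv kk hL ν = 2 * L * L ^ mv) (hw : 0 < L ^ mv) (μ ν : Fin (d + 1)) (p : ScX d L mv kk hL × ι) :
    ∃ z : ℤ, (fun ν (p : ScX d L mv kk hL × ι) => scXi d L mv kk hL ν p.1) ν ((fun μ => liftEquiv (scShift d L mv kk hL μ) ι) μ p) =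
      (fun ν (p : ScX d L mv kk hL × ι) => scXi d L mv kk hL ν p.1) ν p + (if ν = μ then ((((L ^ kk : ℕ) : ℝ)) * ((L ^ mv : ℕ) : ℝ))⁻¹ else 0) + (z : ℝ) * ((2 * L : ℕ) : ℝ) := by
  obtain ⟨z, hz⟩ := coverXi_shift (n := L ^ kk) (q := L) hM hw μ ν (p.1, 0)
  refine ⟨z, ?_⟩
  simp only [liftEquiv_apply]
  exact hz

/-- ★ **THE LIFTED SITE WINDOW**: dag-n15-w4 FILE II §3's cut hypothesis for `χ := fun p => χ_k p.1` on the coloured site carrier — any point within `R + 1` of the cell centre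
`k` in every coordinate, or a `±e_μ`-neighbour of such a point, lies in the box `c(m₀, k) + [0, S)` (FILE V `chiCube_coverCorner_eq_one_of_near_bbox` at the bond `(x, 0)`).
[cite: Balaban1985BackgroundPropagators, (3.62)–(3.65) pp.402–403 (shape)] -/
theorem scChi_lift_eq_one_of_near_bbox {m₀ S : ℕ} (hM : ∀ ν, cvM d L mv kk hL ν = 2 * L * L ^ mv) (hw : 0 < L ^ mv) (hlo : R * (L ^ mv : ℕ) ≤ m₀)
    (hhi : (m₀ : ℝ) + (L ^ mv : ℕ) + (R + 1) * (L ^ mv : ℕ) + 1 ≤ S) (hS : S ≤ 2 * L * L ^ mv) (μ : Fin (d + 1)) (k : Fin (d + 1) → ZMod (2 * L)) (p : ScX d L mv kk hL × ι)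
    (hp : ∃ p₀ : ScX d L mv kk hL × ι, (p₀ = p ∨ p₀ = (fun μ => liftEquiv (scShift d L mv kk hL μ) ι) μ p ∨ p₀ = ((fun μ => liftEquiv (scShift d L mv kk hL μ) ι) μ).symm p) ∧
      ∀ ν, |cenRep (2 * L) ((fun ν (p : ScX d L mv kk hL × ι) => scXi d L mv kk hL ν p.1) ν p₀ - ((k ν).val : ℝ))| < R + 1) :
    (fun p : ScX d L mv kk hL × ι => chiCube (cvM d L mv kk hL) (L ^ kk) (coverCorner (cvM d L mv kk hL) (L ^ mv) L m₀ k) S (p.1, 0)) p = 1 := by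
  obtain ⟨p₀, hp₀, hc⟩ := hp
  refine chiCube_coverCorner_eq_one_of_near_bbox R hM hw hlo hhi hS μ k (p.1, 0) ⟨(p₀.1, 0), ?_, hc⟩
  rcases hp₀ with rfl | rfl | rfl
  · exact Or.inl rfl
  · exact Or.inr (Or.inl (by simp only [liftEquiv_apply]; rfl))
  · refine Or.inr (Or.inr ?_)
    simp only [liftEquiv_symm_apply]
    exact scShift_symm_apply μ p.1

/-- one site step moves the unit block by at most one [hstep]. [folklore] -/
theorem tdistT_scBlk_scShift_le (μ : Fin (d + 1)) (x : ScX d L mv kk hL) :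
    (unitTorusGeo L kk (cvM d L mv kk hL)).dist (scBlk d L mv kk hL (scShift d L mv kk hL μ x)) (scBlk d L mv kk hL x) ≤ 1 := by
  have h := tdistT_blockOf_sub_unitVec_le (L ^ kk) (cvM d L mv kk hL) (x + unitVec (fine (L ^ kk) (cvM d L mv kk hL)) μ) μ
  rw [add_sub_cancel_right, tdistT_symm] at h
  exact h

end Coordinates

/-! ## §3 The flat operator on sites: `Σ∇*∇ = ∂ᵀ∂ ⊗ 1`, `Δ′_a(1)G′(1) = 1`, the plateau identities, the exact locality -/

section Flat

variable {L : ℕ} [NeZero L] {mv kk : ℕ} {hL : Odd L ∧ 1 < L} (ι : Type) [Fintype ι] [DecidableEq ι]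

/-- ★ `Σ_μ ∇*_μ∇_μ` (FILE 52's `lapOp` on the lifted site shifts, weight `n = L^k`) IS `mulVecLin (∂ᵀ∂ ⊗ 1_ι)` = `mulVecLin ((D_1)ᵀ D_1)`. [cite: Balaban1985BackgroundPropagators, (3.23)–(3.24) p.394 (at `U ≡ 1`)] -/
theorem lapOp_scShift_eq :
    lapOp (((L ^ kk : ℕ) : ℝ)) (fun μ => liftEquiv (scShift d L mv kk hL μ) ι) 0 =
      Matrix.mulVecLin ((cgrad (cvM d L mv kk hL) (L ^ kk) (fun (_ : Fin (d + 1)) (_ : ScX d L mv kk hL) => (1 : Matrix ι ι ℝ)))ᵀ *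
        cgrad (cvM d L mv kk hL) (L ^ kk) (fun (_ : Fin (d + 1)) (_ : ScX d L mv kk hL) => (1 : Matrix ι ι ℝ))) := by
  refine LinearMap.ext fun f => funext fun p => ?_
  obtain ⟨z, i⟩ := p
  rw [Matrix.mulVecLin_apply, ← Matrix.mulVec_mulVec, cgrad_one_transpose_mulVec]
  simp only [lapOp, lapDir, add_zero, LinearMap.coe_sum, Finset.sum_apply, LinearMap.comp_apply, fgradAdj_apply, fgrad_apply,
    liftEquiv_apply, liftEquiv_symm_apply, Equiv.addRight_symm, Equiv.coe_addRight, cgrad_mulVec, Matrix.one_apply, ite_mul, one_mul, zero_mul, Finset.sum_ite_eq,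
    Finset.mem_univ, if_true, ← sub_eq_add_neg, sub_add_cancel]

/-- ★★ **`Δ′_a(1)∘G′(1) = 1` IN 52's VOCABULARY**: `(Σ_μ∇*_μ∇_μ + a·Q′ᵀQ′ ⊗ 1)∘mulVecLin (G′(1)) = id` for `a > 0` (n15-c∕201b `claplA_mul_cGreen` at `T ≡ 1`).
[cite: Balaban1985BackgroundPropagators, (3.24)–(3.25) p.394, p.395 l.1–3 (Δ′_a invertible)] -/
theorem lapOp_add_scQQ_comp_cGreen {a : ℝ} (ha : 0 < a) :
    (lapOp (((L ^ kk : ℕ) : ℝ)) (fun μ => liftEquiv (scShift d L mv kk hL μ) ι) 0 + scQQ d L mv kk hL a ι) ∘ₗ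
        Matrix.mulVecLin (cGreen (cvM d L mv kk hL) (L ^ kk) (fun (_ : Fin (d + 1)) (_ : ScX d L mv kk hL) => (1 : Matrix ι ι ℝ)) a) = LinearMap.id := by
  rw [lapOp_scShift_eq, scQQ, ← Matrix.mulVecLin_add, ← Matrix.mulVecLin_mul]
  have h : (cgrad (cvM d L mv kk hL) (L ^ kk) (fun (_ : Fin (d + 1)) (_ : ScX d L mv kk hL) => (1 : Matrix ι ι ℝ)))ᵀ *
        cgrad (cvM d L mv kk hL) (L ^ kk) (fun (_ : Fin (d + 1)) (_ : ScX d L mv kk hL) => (1 : Matrix ι ι ℝ)) +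
      a • ((csavg (cvM d L mv kk hL) (L ^ kk) (fun (_ : Fin (d + 1)) (_ : ScX d L mv kk hL) => (1 : Matrix ι ι ℝ)))ᵀ *
        csavg (cvM d L mv kk hL) (L ^ kk) (fun (_ : Fin (d + 1)) (_ : ScX d L mv kk hL) => (1 : Matrix ι ι ℝ))) =
      claplA (cvM d L mv kk hL) (L ^ kk) (fun (_ : Fin (d + 1)) (_ : ScX d L mv kk hL) => (1 : Matrix ι ι ℝ)) a := rfl
  rw [h, claplA_mul_cGreen (cvM d L mv kk hL) (L ^ kk) (fun _ _ => isUnit_one) ha, Matrix.mulVecLin_one]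

omit [Fintype ι] [DecidableEq ι] in
/-- `M_{h_k}∘M_{ψ_k} = M_{h_k}` [hhψ]: the plateau covers the cell (FILE 66 `chiCube_coverCorner_eq_one` at `(x, 0)`, window `m₀ + 2w + 1 ≤ Lw`). [cite: Balaban1984PropagatorsII, (2.37) p.229 (shape)] -/
theorem mulOp_scH_comp_mulOp_scPsi (hM : ∀ ν, cvM d L mv kk hL ν = 2 * L * L ^ mv) (hw : 0 < L ^ mv) (hfit : coverMargin L mv + 2 * L ^ mv + 1 ≤ L * L ^ mv)
    (k : Fin (d + 1) → ZMod (2 * L)) :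
    mulOp (fun p : ScX d L mv kk hL × ι => scH d L mv kk hL k p.1) ∘ₗ mulOp (fun p : ScX d L mv kk hL × ι => scPsi d L mv kk hL k p.1) =
      mulOp (fun p : ScX d L mv kk hL × ι => scH d L mv kk hL k p.1) :=
  mulOp_comp_mulOp_of_support fun p hp =>
    chiCube_coverCorner_eq_one hM hw hfit 0 k (p.1, 0) ⟨(p.1, 0), Or.inl rfl, abs_cenRep_lt_one_of_hcube_ne_zero (2 * L) (coverXi (cvM d L mv kk hL) (L ^ kk) (L ^ mv)) hp⟩

omit [Fintype ι] [DecidableEq ι] in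
/-- `M_{ψ_k}∘M_{ψ_k} = M_{ψ_k}`. [folklore] -/
theorem mulOp_scPsi_idem (k : Fin (d + 1) → ZMod (2 * L)) :
    mulOp (fun p : ScX d L mv kk hL × ι => scPsi d L mv kk hL k p.1) ∘ₗ mulOp (fun p : ScX d L mv kk hL × ι => scPsi d L mv kk hL k p.1) =
      mulOp (fun p : ScX d L mv kk hL × ι => scPsi d L mv kk hL k p.1) :=
  mulOp_comp_mulOp_of_support fun _ hp => chiCube_eq_one_of_ne_zero hp

/-- `N_k∘M_{ψ_k} = N_k` [hNψ]: the compressed Green's function only reads sources in the cube. [cite: Balaban1985BackgroundPropagators, (3.87) p.409 (shape)] -/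
theorem scCube_comp_mulOp_scPsi (a : ℝ) (k : Fin (d + 1) → ZMod (2 * L)) :
    scCube d L mv kk hL a ι k ∘ₗ mulOp (fun p : ScX d L mv kk hL × ι => scPsi d L mv kk hL k p.1) = scCube d L mv kk hL a ι k := by
  rw [scCube, LinearMap.comp_assoc, mulOp_scPsi_idem]

/-- ★★ **52's EXACT LOCALITY [hloc0] FOR THE COMPRESSED TORUS GREEN's FUNCTION**: `M_{h_k}∘(Σ∇*∇ + a·Q′ᵀQ′ ⊗ 1)∘(G′(1)∘M_{ψ_k}) = M_{h_k}∘M_{ψ_k} = M_{h_k}` (`a > 0`).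
[cite: Balaban1985BackgroundPropagators, (3.87)–(3.88) p.409 (mechanism); Balaban1984PropagatorsII, (2.91) p.239] -/
theorem loc0_scCube (hM : ∀ ν, cvM d L mv kk hL ν = 2 * L * L ^ mv) (hw : 0 < L ^ mv) (hfit : coverMargin L mv + 2 * L ^ mv + 1 ≤ L * L ^ mv) {a : ℝ} (ha : 0 < a)
    (k : Fin (d + 1) → ZMod (2 * L)) :
    mulOp (fun p : ScX d L mv kk hL × ι => scH d L mv kk hL k p.1) ∘ₗ (lapOp (((L ^ kk : ℕ) : ℝ)) (fun μ => liftEquiv (scShift d L mv kk hL μ) ι) 0 + scQQ d L mv kk hL a ι) ∘ₗ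
        scCube d L mv kk hL a ι k = mulOp (fun p : ScX d L mv kk hL × ι => scH d L mv kk hL k p.1) := by
  rw [scCube, ← LinearMap.comp_assoc (mulOp fun p : ScX d L mv kk hL × ι => scPsi d L mv kk hL k p.1), lapOp_add_scQQ_comp_cGreen ι ha, LinearMap.id_comp,
    mulOp_scH_comp_mulOp_scPsi ι hM hw hfit]

end Flat

/-! ## §4 Block locality of `a·Q′ᵀQ′ ⊗ 1`: the tail row vanishes, the commutator row is the in-block oscillation -/

section Locality

variable {L : ℕ} [NeZero L] {mv kk : ℕ} {hL : Odd L ∧ 1 < L} (ι : Type) [Fintype ι] [DecidableEq ι]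

/-- ★ **`a·Q′ᵀQ′ ⊗ 1` IS AN IN-BLOCK SUM, DIAGONAL IN THE COLOUR**: `(N_L f)(x, i) = a·n^{−(d+1)}·n^{−(d+1)}·Σ_{x′ : B(x′) = B(x)} f(x′, i)` (n15-c∕250
`csavg_transpose_mul_csavg_apply` at `T ≡ 1`, `cvaStair 1 = 1`). [cite: Balaban1984PropagatorsI, (1.20) p.20 (the block average: shape)] -/
theorem scQQ_apply (a : ℝ) (f : ScX d L mv kk hL × ι → ℝ) (p : ScX d L mv kk hL × ι) :
    scQQ d L mv kk hL a ι f p = a * (((((L ^ kk : ℕ) : ℝ)) ^ (d + 1))⁻¹ * ((((L ^ kk : ℕ) : ℝ)) ^ (d + 1))⁻¹) *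
      ∑ x' : ScX d L mv kk hL, (if blockOf (L ^ kk) (cvM d L mv kk hL) x' = blockOf (L ^ kk) (cvM d L mv kk hL) p.1 then f (x', p.2) else 0) := by
  classical
  simp only [scQQ, Matrix.mulVecLin_apply, Matrix.mulVec, dotProduct, Fintype.sum_prod_type, Matrix.smul_apply, smul_eq_mul,
    csavg_transpose_mul_csavg_apply, cvaStair_one, Matrix.one_apply, Nat.cast_pow]
  rw [Finset.mul_sum]
  refine Finset.sum_congr rfl fun x' _ => ?_
  by_cases hb : blockOf (L ^ kk) (cvM d L mv kk hL) x' = blockOf (L ^ kk) (cvM d L mv kk hL) p.1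
  · rw [Finset.sum_eq_single p.2 (fun j _ hj => by simp [hj]) (fun h => absurd (Finset.mem_univ _) h)]
    simp [hb]
  · simp [hb]

/-- inside one unit block the site coordinates differ by at most `1∕w`: `B(x′) = B(x) ⟹ |ξ_ν(x′) − ξ_ν(x)| ≤ (L^m)⁻¹`. [folklore] -/
theorem abs_scXi_sub_scXi_le_of_blockOf_eq (hw : 0 < L ^ mv) {x x' : ScX d L mv kk hL} (hb : blockOf (L ^ kk) (cvM d L mv kk hL) x' = blockOf (L ^ kk) (cvM d L mv kk hL) x)
    (ν : Fin (d + 1)) : |scXi d L mv kk hL ν x' - scXi d L mv kk hL ν x| ≤ (((L ^ mv : ℕ) : ℝ))⁻¹ := by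
  have hn : 0 < L ^ kk := Nat.pos_of_ne_zero (NeZero.ne _)
  have hnr : (0 : ℝ) < ((L ^ kk : ℕ) : ℝ) := by exact_mod_cast hn
  have hwr : (0 : ℝ) < ((L ^ mv : ℕ) : ℝ) := by exact_mod_cast hw
  have hq : (x' ν).val / L ^ kk = (x ν).val / L ^ kk := by
    have h1 := val_blockOf (N := L ^ kk) (M' := cvM d L mv kk hL) x' ν
    have h2 := val_blockOf (N := L ^ kk) (M' := cvM d L mv kk hL) x ν
    rw [← h1, ← h2, hb]
  obtain ⟨Q, r1, r2, e1, e2, hr1, hr2⟩ : ∃ Q r1 r2 : ℕ, (x' ν).val = L ^ kk * Q + r1 ∧ (x ν).val = L ^ kk * Q + r2 ∧ r1 < L ^ kk ∧ r2 < L ^ kk :=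
    ⟨(x ν).val / L ^ kk, (x' ν).val % L ^ kk, (x ν).val % L ^ kk, by rw [← hq]; exact (Nat.div_add_mod _ _).symm, (Nat.div_add_mod _ _).symm, Nat.mod_lt _ hn, Nat.mod_lt _ hn⟩
  have hdiff : |(((x' ν).val : ℕ) : ℝ) - (((x ν).val : ℕ) : ℝ)| ≤ ((L ^ kk : ℕ) : ℝ) := by
    rw [e1, e2, Nat.cast_add, Nat.cast_add, Nat.cast_mul]
    have hr1' : ((r1 : ℕ) : ℝ) < ((L ^ kk : ℕ) : ℝ) := by exact_mod_cast hr1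
    have hr2' : ((r2 : ℕ) : ℝ) < ((L ^ kk : ℕ) : ℝ) := by exact_mod_cast hr2
    have hr1'' : (0 : ℝ) ≤ ((r1 : ℕ) : ℝ) := Nat.cast_nonneg _
    have hr2'' : (0 : ℝ) ≤ ((r2 : ℕ) : ℝ) := Nat.cast_nonneg _
    rw [abs_le]
    constructor <;> linarith
  show |coverXi (cvM d L mv kk hL) (L ^ kk) (L ^ mv) ν (x', 0) - coverXi (cvM d L mv kk hL) (L ^ kk) (L ^ mv) ν (x, 0)| ≤ _
  unfold coverXi
  rw [show ((x', (0 : Fin (d + 1))).1 ν) = x' ν from rfl, show ((x, (0 : Fin (d + 1))).1 ν) = x ν from rfl, ← sub_div, abs_div,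
    abs_of_pos (by positivity : (0 : ℝ) < ((L ^ kk : ℕ) : ℝ) * ((L ^ mv : ℕ) : ℝ)), div_le_iff₀ (by positivity)]
  calc |(((x' ν).val : ℕ) : ℝ) - (((x ν).val : ℕ) : ℝ)| ≤ ((L ^ kk : ℕ) : ℝ) := hdiff
    _ = (((L ^ mv : ℕ) : ℝ))⁻¹ * (((L ^ kk : ℕ) : ℝ) * ((L ^ mv : ℕ) : ℝ)) := by field_simp

/-- the bump covers every block met by the cell: `h_k(x) ≠ 0`, `B(x′) = B(x)`, `w ≥ 1` ⟹ `χ̃_k(x′) = 1` (radius `2 ≥ 1 + 1∕w`). [cite: Balaban1985BackgroundPropagators, (3.62)–(3.65) pp.402–403 (nested cut-offs: shape)] -/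
theorem scBump_eq_one_of_scH_ne_zero_of_blockOf_eq (hw : 0 < L ^ mv) {k : Fin (d + 1) → ZMod (2 * L)} {x x' : ScX d L mv kk hL} (hx : scH d L mv kk hL k x ≠ 0)
    (hb : blockOf (L ^ kk) (cvM d L mv kk hL) x' = blockOf (L ^ kk) (cvM d L mv kk hL) x) : scBump d L mv kk hL k x' = 1 := by
  have hK : 0 < 2 * L := by have := Nat.pos_of_ne_zero (NeZero.ne L); omega
  have hwr : (1 : ℝ) ≤ ((L ^ mv : ℕ) : ℝ) := by exact_mod_cast hw
  refine bcube_eq_one_of_forall_abs_cenRep_le (2 * L) (scXi d L mv kk hL) 2 fun ν => ?_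
  have h1 := abs_cenRep_lt_one_of_hcube_ne_zero (2 * L) (scXi d L mv kk hL) hx ν
  have h2 := abs_scXi_sub_scXi_le_of_blockOf_eq (d := d) hw hb ν
  have h3 := abs_cenRep_shift_le (2 * L) hK (scXi d L mv kk hL ν x - ((k ν).val : ℝ)) (scXi d L mv kk hL ν x' - scXi d L mv kk hL ν x) 0
  rw [Int.cast_zero, zero_mul, add_zero, show scXi d L mv kk hL ν x - ((k ν).val : ℝ) + (scXi d L mv kk hL ν x' - scXi d L mv kk hL ν x) = scXi d L mv kk hL ν x' - ((k ν).val : ℝ) by ring] at h3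
  have h4 : (((L ^ mv : ℕ) : ℝ))⁻¹ ≤ 1 := inv_le_one_of_one_le₀ hwr
  linarith

/-- ★★ **52's TAIL OPERATOR VANISHES FOR A BLOCK-DIAGONAL NONLOCAL PART**: `M_{h_k}∘(a·Q′ᵀQ′ ⊗ 1)∘M_{1−χ̃_k} = 0` (every block met by `supp h_k` lies under the plateau of `χ̃_k`) —
so [hT] holds with `ε₀ = 0`. [cite: Balaban1984PropagatorsII, (2.92)–(2.93) p.239 (the tail term: shape)] -/
theorem mulOp_scH_comp_scQQ_comp_one_sub_scBump (hw : 0 < L ^ mv) (a : ℝ) (k : Fin (d + 1) → ZMod (2 * L)) :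
    mulOp (fun p : ScX d L mv kk hL × ι => scH d L mv kk hL k p.1) ∘ₗ scQQ d L mv kk hL a ι ∘ₗ mulOp (1 - fun p : ScX d L mv kk hL × ι => scBump d L mv kk hL k p.1) = 0 := by
  classical
  refine LinearMap.ext fun f => funext fun p => ?_
  rw [LinearMap.comp_apply, LinearMap.comp_apply, mulOp_apply, LinearMap.zero_apply, Pi.zero_apply]
  by_cases hx : scH d L mv kk hL k p.1 = 0
  · rw [hx, zero_mul]
  · rw [scQQ_apply]
    have hzero : ∑ x' : ScX d L mv kk hL, (if blockOf (L ^ kk) (cvM d L mv kk hL) x' = blockOf (L ^ kk) (cvM d L mv kk hL) p.1 then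
        mulOp (1 - fun p : ScX d L mv kk hL × ι => scBump d L mv kk hL k p.1) f (x', p.2) else 0) = 0 := by
      refine Finset.sum_eq_zero fun x' _ => ?_
      by_cases hb : blockOf (L ^ kk) (cvM d L mv kk hL) x' = blockOf (L ^ kk) (cvM d L mv kk hL) p.1
      · rw [if_pos hb, mulOp_apply, Pi.sub_apply, Pi.one_apply, scBump_eq_one_of_scH_ne_zero_of_blockOf_eq hw hx hb, sub_self, zero_mul]
      · rw [if_neg hb]
    rw [hzero, mul_zero, mul_zero]

/-- the in-block oscillation of `h_k` on the coloured site carrier: `B(x′) = B(x) ⟹ |h_k(x′) − h_k(x)| ≤ 2π(d+1)∕w` (FILE 67 `abs_coverH_sub_coverHb_le` twice). [cite: Balaban1984PropagatorsII, (2.36) p.229 (shape)] -/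
theorem abs_scH_sub_scH_le_of_blockOf_eq (hM : ∀ ν, cvM d L mv kk hL ν = 2 * L * L ^ mv) (hw : 0 < L ^ mv) (k : Fin (d + 1) → ZMod (2 * L)) {x x' : ScX d L mv kk hL}
    (hb : blockOf (L ^ kk) (cvM d L mv kk hL) x' = blockOf (L ^ kk) (cvM d L mv kk hL) x) :
    |scH d L mv kk hL k x' - scH d L mv kk hL k x| ≤ 2 * (π * (d + 1) / (L ^ mv : ℕ)) := by
  have h1 := abs_coverH_sub_coverHb_le (q := L) hM hw k (x', 0)
  have h2 := abs_coverH_sub_coverHb_le (q := L) hM hw k (x, 0)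
  rw [show ((x', (0 : Fin (d + 1))) : ScX d L mv kk hL × Fin (d + 1)).1 = x' from rfl, hb] at h1
  rw [show ((x, (0 : Fin (d + 1))) : ScX d L mv kk hL × Fin (d + 1)).1 = x from rfl] at h2
  have h3 := abs_sub_le (hcube (2 * L) (coverXi (cvM d L mv kk hL) (L ^ kk) (L ^ mv)) k (x', 0)) (coverHb (cvM d L mv kk hL) (L ^ kk) (L ^ mv) L k (blockOf (L ^ kk) (cvM d L mv kk hL) x))
    (hcube (2 * L) (coverXi (cvM d L mv kk hL) (L ^ kk) (L ^ mv)) k (x, 0))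
  rw [abs_sub_comm (coverHb (cvM d L mv kk hL) (L ^ kk) (L ^ mv) L k (blockOf (L ^ kk) (cvM d L mv kk hL) x))] at h3
  have e : scH d L mv kk hL k x' - scH d L mv kk hL k x = hcube (2 * L) (coverXi (cvM d L mv kk hL) (L ^ kk) (L ^ mv)) k (x', 0) - hcube (2 * L) (coverXi (cvM d L mv kk hL) (L ^ kk) (L ^ mv)) k (x, 0) := rfl
  rw [e]
  linarith

/-- ★★ **52's COMMUTATOR ROW [hKN] FOR THE BLOCK-DIAGONAL NONLOCAL PART**: `[a·Q′ᵀQ′ ⊗ 1, M_{h_k}] ≤ (|a|·n^{−(d+1)})·2π(d+1)∕w·e^{−ρ|y−y′|_T}` for every `ρ` (the kernel is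
block-diagonal; `(a Q′ᵀQ′ ⊗ 1)` has row sums `|a| n^{−(d+1)}` per block; the oscillation of `h_k` over a block is `≤ 2π(d+1)∕w`).
[cite: Balaban1985BackgroundPropagators, (3.88)–(3.89) p.409 («K(h_□)… O(M⁻¹)»: shape); Balaban1984PropagatorsI, (1.126)–(1.128) p.38] -/
theorem hasMaj_commOp_scQQ (hM : ∀ ν, cvM d L mv kk hL ν = 2 * L * L ^ mv) (hw : 0 < L ^ mv) (a ρ : ℝ) (k : Fin (d + 1) → ZMod (2 * L)) :
    HasMaj (ScNorm d L mv kk hL ι) (ScNorm d L mv kk hL ι) (commOp (scQQ d L mv kk hL a ι) (fun p : ScX d L mv kk hL × ι => scH d L mv kk hL k p.1))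
      (fun y y' => (|a| * ((((L ^ kk : ℕ) : ℝ)) ^ (d + 1))⁻¹) * (2 * (π * (d + 1) / (L ^ mv : ℕ))) * Real.exp (-(ρ * (unitTorusGeo L kk (cvM d L mv kk hL)).dist y y'))) := by
  classical
  intro y' f hf y
  dsimp only
  have hnr : (0 : ℝ) < ((L ^ kk : ℕ) : ℝ) := by exact_mod_cast Nat.pos_of_ne_zero (NeZero.ne _)
  have hc0 : 0 ≤ ((((L ^ kk : ℕ) : ℝ)) ^ (d + 1))⁻¹ * ((((L ^ kk : ℕ) : ℝ)) ^ (d + 1))⁻¹ := by positivity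
  have hω0 : 0 ≤ 2 * (π * (d + 1) / (L ^ mv : ℕ)) := by positivity
  have hF0 := (ScNorm d L mv kk hL ι).loc_nonneg y' f
  -- pointwise: the commutator is an in-block sum of `a·c·(h(x′) − h(x))·f(x′, i)`
  have hpt : ∀ p : ScX d L mv kk hL × ι, commOp (scQQ d L mv kk hL a ι) (fun p : ScX d L mv kk hL × ι => scH d L mv kk hL k p.1) f p =
      a * (((((L ^ kk : ℕ) : ℝ)) ^ (d + 1))⁻¹ * ((((L ^ kk : ℕ) : ℝ)) ^ (d + 1))⁻¹) * ∑ x' : ScX d L mv kk hL, (if blockOf (L ^ kk) (cvM d L mv kk hL) x' = blockOf (L ^ kk) (cvM d L mv kk hL) p.1 then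
        (scH d L mv kk hL k x' - scH d L mv kk hL k p.1) * f (x', p.2) else 0) := by
    intro p
    rw [commOp, LinearMap.sub_apply, LinearMap.comp_apply, LinearMap.comp_apply, Pi.sub_apply, mulOp_apply, scQQ_apply, scQQ_apply]
    simp only [mulOp_apply, Finset.mul_sum, ← Finset.sum_sub_distrib]
    refine Finset.sum_congr rfl fun x' _ => ?_
    by_cases hb : blockOf (L ^ kk) (cvM d L mv kk hL) x' = blockOf (L ^ kk) (cvM d L mv kk hL) p.1
    · simp only [if_pos hb]; ring
    · simp only [if_neg hb, mul_zero, sub_self]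
  by_cases hy : y = y'
  · subst hy
    rw [tdistT_self, mul_zero, neg_zero, Real.exp_zero, mul_one]
    refine loc_ofBlocks_le (g := unitTorusGeo L kk (cvM d L mv kk hL)) (liftBlk (scBlk d L mv kk hL) ι) _ (by positivity) fun p hp => ?_
    rw [hpt p, abs_mul, abs_mul, abs_of_nonneg hc0]
    have hsum : |∑ x' : ScX d L mv kk hL, (if blockOf (L ^ kk) (cvM d L mv kk hL) x' = blockOf (L ^ kk) (cvM d L mv kk hL) p.1 then (scH d L mv kk hL k x' - scH d L mv kk hL k p.1) * f (x', p.2) else 0)| ≤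
        ∑ x' : ScX d L mv kk hL, (if blockOf (L ^ kk) (cvM d L mv kk hL) x' = blockOf (L ^ kk) (cvM d L mv kk hL) p.1 then (2 * (π * (d + 1) / (L ^ mv : ℕ))) * (ScNorm d L mv kk hL ι).loc y f else 0) := by
      refine (Finset.abs_sum_le_sum_abs _ _).trans (Finset.sum_le_sum fun x' _ => ?_)
      by_cases hb : blockOf (L ^ kk) (cvM d L mv kk hL) x' = blockOf (L ^ kk) (cvM d L mv kk hL) p.1
      · rw [if_pos hb, if_pos hb, abs_mul]
        exact mul_le_mul (abs_scH_sub_scH_le_of_blockOf_eq hM hw k hb)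
          (abs_le_loc_ofBlocks (g := unitTorusGeo L kk (cvM d L mv kk hL)) (liftBlk (scBlk d L mv kk hL) ι) f (show liftBlk (scBlk d L mv kk hL) ι (x', p.2) = y from hb.trans hp)) (abs_nonneg _) hω0
      · rw [if_neg hb, if_neg hb, abs_zero]
    have hcard : ∑ x' : ScX d L mv kk hL, (if blockOf (L ^ kk) (cvM d L mv kk hL) x' = blockOf (L ^ kk) (cvM d L mv kk hL) p.1 then (2 * (π * (d + 1) / (L ^ mv : ℕ))) * (ScNorm d L mv kk hL ι).loc y f else 0) =
        ((L ^ kk : ℕ) : ℝ) ^ (d + 1) * ((2 * (π * (d + 1) / (L ^ mv : ℕ))) * (ScNorm d L mv kk hL ι).loc y f) := by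
      rw [← Finset.sum_filter, Finset.sum_const, nsmul_eq_mul]
      congr 1
      have := card_fibre_blockOf_fine (cvM d L mv kk hL) (L ^ kk) (blockOf (L ^ kk) (cvM d L mv kk hL) p.1)
      rw [T4EtaRateCoeffDefect.fibre] at this
      exact_mod_cast this
    calc |a| * (((((L ^ kk : ℕ) : ℝ)) ^ (d + 1))⁻¹ * ((((L ^ kk : ℕ) : ℝ)) ^ (d + 1))⁻¹) *
          |∑ x' : ScX d L mv kk hL, (if blockOf (L ^ kk) (cvM d L mv kk hL) x' = blockOf (L ^ kk) (cvM d L mv kk hL) p.1 then (scH d L mv kk hL k x' - scH d L mv kk hL k p.1) * f (x', p.2) else 0)|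
        ≤ |a| * (((((L ^ kk : ℕ) : ℝ)) ^ (d + 1))⁻¹ * ((((L ^ kk : ℕ) : ℝ)) ^ (d + 1))⁻¹) * (((L ^ kk : ℕ) : ℝ) ^ (d + 1) * ((2 * (π * (d + 1) / (L ^ mv : ℕ))) * (ScNorm d L mv kk hL ι).loc y f)) :=
          mul_le_mul_of_nonneg_left (hsum.trans hcard.le) (by positivity)
      _ = |a| * ((((L ^ kk : ℕ) : ℝ)) ^ (d + 1))⁻¹ * (2 * (π * (d + 1) / (L ^ mv : ℕ))) * (ScNorm d L mv kk hL ι).loc y f := by field_simp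
  · -- off the diagonal the commutator vanishes on the block of `y`
    refine (loc_ofBlocks_le (g := unitTorusGeo L kk (cvM d L mv kk hL)) (liftBlk (scBlk d L mv kk hL) ι) _ le_rfl fun p hp => ?_).trans (by positivity)
    rw [hpt p]
    have hzero : ∑ x' : ScX d L mv kk hL, (if blockOf (L ^ kk) (cvM d L mv kk hL) x' = blockOf (L ^ kk) (cvM d L mv kk hL) p.1 then (scH d L mv kk hL k x' - scH d L mv kk hL k p.1) * f (x', p.2) else 0) = 0 := by
      refine Finset.sum_eq_zero fun x' _ => ?_
      by_cases hb : blockOf (L ^ kk) (cvM d L mv kk hL) x' = blockOf (L ^ kk) (cvM d L mv kk hL) p.1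
      · rw [if_pos hb, hf (x', p.2) (show liftBlk (scBlk d L mv kk hL) ι (x', p.2) ≠ y' from fun h => hy (hp.symm.trans (hb.symm.trans h))), mul_zero]
      · rw [if_neg hb]
    rw [hzero, mul_zero, abs_zero]

end Locality

end Summit.QuantumFields.YangMills.BalabanUVNodes.N15.Gluing

end
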